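import Summits.Ventures.CertifiedQuantumChemistry.Rows.HubbardRingTVGroundStateSymmetry
import Summits.Ventures.CertifiedQuantumChemistry.Rows.SectorEnergyConcavity
import HarnessLib

/-!
# Ventures/CertifiedQuantumChemistry — Rows/HubbardRingTVDoubleOccupancyMonotone.lean: the ground-state
# DOUBLE OCCUPANCY of the half-filled even TV-H ring is a NON-INCREASING function of `U` (Griffiths /
# Feynman–Hellmann on the `U`-pencil, Lieb uniqueness), and the exact energy obeys
# `E₀(U′) ≤ E₀(U) + (U′ − U)·2n·d(U)`

HONEST FRAMING (verbatim): certified bounds for a stated model Hamiltonian in a stated basis; not a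
claim about the real molecule beyond that model.

Seat rdm-B, ROWS courtesy file (theorems only; no `def`, no notation, no instance; zero compute). The
relaxation side of STRUCTURE §2.2.8 (3) ("the doublon reading") is gen 36's
`Rows/HubbardRingTVDoublonSupergradient.lean` (the optimal doublon weight is a supergradient of
`U ↦ OPT_X`, optimal doublon weights are antitone in `U`). This file is the EXACT side on the cell's
model `hubbardRingTV (2n) t U` (`t ≠ 0`, `U > 0`): the Hamiltonian is the pencil
`Ĥ(t, U) = Ĥ(t, 0) + U·Ĥ(0, 1)` (`Rows/SectorEnergyConcavity.lean`) with `Ĥ(0, 1) = Σ_p n_{p↑} n_{p↓}`, the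
`2n`-electron ground state is unique (Lieb) and lives in the sector `(n, n)`, so the tree's Griffiths
lemma (`Literature/…/GriffithsLemmaGroundStates.lean`: supergradient inequality and antitonicity of the
conjugate observable along a Hermitian pencil) applies to `Y = Σ_p n_{p↑} n_{p↓}`:

* §1 `hubbardRingTV_groundState_mem_szSector` / `…_isInSector` (a half-filled ground state of
  `hubbardRingTV (2n) t U` lies in the `S_z = 0` sector `(n, n)`), `hubbardRingTV_groundState_re_rayleigh`
  (a UNIT ground state realises `minEnergyOn` of the pencil on that sector), `hubbardRingTV_onsite_hamiltonian`
  (`Ĥ(L; 0, 1) = Σ_p n_{p↑} n_{p↓}`), `hubbardRingTV_expect_onsite` (`⟨ψ, Ĥ(0,1) ψ⟩ = Σ_p ⟨n_{p↑} n_{p↓}⟩_ψ`).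
* §2 **`hubbardRingTV_energy_le_add_mul_doubleOccupancy`** (FEYNMAN–HELLMANN SUPERGRADIENT with the
  ground state's own double occupancy: `E₀(2n; t, U′; n, n) ≤ E₀(2n; t, U; n, n) + (U′ − U)·Σ_p ⟨n_{p↑} n_{p↓}⟩_{ψ_U}`
  for every `U′`, `ψ_U` a unit ground state at `U > 0`, `t ≠ 0`);
  **`hubbardRingTV_doubleOccupancy_total_antitone`** (`0 < U < U′` ⇒
  `Σ_p ⟨n_{p↑} n_{p↓}⟩_{ψ_{U′}} ≤ Σ_p ⟨n_{p↑} n_{p↓}⟩_{ψ_U}`) and, with the uniformity of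
  `Rows/HubbardRingTVGroundStateSymmetry.lean`, the per-site form
  **`hubbardRingTV_doubleOccupancy_antitone`**: `⟨n_{p↑} n_{p↓}⟩_{ψ_{U′}} ≤ ⟨n_{q↑} n_{q↓}⟩_{ψ_U}` for ALL sites
  `p, q` — THE GROUND-STATE DOUBLE OCCUPANCY OF THE HALF-FILLED RING IS NON-INCREASING IN `U`.

READING: statements about unit ground states of the cell's own model object (which exist and are unique
up to phase for `t ≠ 0`, `U > 0`); nothing about the relaxation, no certificate, row or value of record.
All PROVED (0 sorry, standard axioms); no definitions, no named facts. References (docstring-only):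
R. B. Griffiths, Phys. Rev. 152 (1966) 240 §II–III; R. P. Feynman, Phys. Rev. 56 (1939) 340; E. H. Lieb,
Phys. Rev. Lett. 62 (1989) 1201, Thm 2. Tree (REUSED): `minEnergyOn_pencil_le_of_ground`,
`re_rayleigh_ground_antitone` (Griffiths lemma file), `LiebHalfFilled.exists_unit_groundState`,
`LiebHalfFilled.groundState_unique`, `groundEnergyAt_eq_minEnergyOn_szSector`,
`hubbardRingTV_hamiltonian_pencil` (`Rows/SectorEnergyConcavity`), `hubbardRingTV_hamiltonian_eq`,
`hubbardRingTV_groundState_doubleOccupancy_eq` (the sibling file).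
-/

noncomputable section

namespace Summit.Ventures.CertifiedQuantumChemistry

open Matrix Finset
open Literature.MathematicalPhysics.QuantumLattice Literature.MathematicalPhysics.QuantumChemistry
open Summit.Ventures.CertifiedQuantumChemistry.Hamiltonians
open scoped ComplexOrder

section DoubleOccupancy

variable {n : ℕ} {t U : ℚ} {ψ : Fock (Orb (Fin (2 * n)))}

/-! ## §1 The ground state lives in the `S_z = 0` sector and realises the pencil's sector minimum -/

/-- **A half-filled ground state of the even ring lies in the `S_z = 0` sector** (`t ≠ 0`, `U > 0`): it is
a multiple of Lieb's unique singlet ground state. [folklore] -/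
theorem hubbardRingTV_groundState_mem_szSector (hn : 1 ≤ n) (ht : t ≠ 0) (hU : 0 < U)
    (hψ : IsGroundState (hubbardRingTV (2 * n) t U).hamiltonian (2 * n) ψ) :
    ψ ∈ szSector (2 * n) (0 : ℝ) := by
  obtain ⟨ψ₀, hψ₀K, hψ₀1, hHψ₀, -, -, -⟩ := LiebHalfFilled.exists_unit_groundState
    (ringGraph_connected (by omega : 0 < 2 * n)) (evenSites (2 * n)) (evenSites_bipartite n)
    (card_compl_evenSites n) (t := (t : ℝ)) (U := (U : ℝ)) (by exact_mod_cast ht) (by exact_mod_cast hU)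
  rw [Fintype.card_fin] at hψ₀K hHψ₀
  have hψ₀S : IsInSector n n ψ₀ := by
    rw [← mem_szSector_iff_isInSector, show n + n = 2 * n by ring, sub_self, zero_div]
    exact hψ₀K
  have hψ₀g : IsGroundState (hamiltonian (ringGraph (2 * n)) (t : ℝ) (U : ℝ)) (Fintype.card (Fin (2 * n))) ψ₀ := by
    rw [Fintype.card_fin]
    refine ⟨?_, fun h0 => ?_, hHψ₀⟩
    · have h := hψ₀S.isNParticle
      rwa [show n + n = 2 * n by ring] at h
    · rw [h0, dotProduct_zero] at hψ₀1
      exact zero_ne_one hψ₀1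
  obtain ⟨a, ha⟩ := LiebHalfFilled.groundState_unique (ringGraph_connected (by omega : 0 < 2 * n))
    (evenSites (2 * n)) (evenSites_bipartite n) (card_compl_evenSites n)
    (by exact_mod_cast ht) (by exact_mod_cast hU) hψ₀g (hubbardRingTV_isGroundState_graph hψ)
  rw [ha]
  exact Submodule.smul_mem _ a hψ₀K

/-- … i.e. it is supported in the sector `(N_α, N_β) = (n, n)`. [folklore] -/
theorem hubbardRingTV_groundState_isInSector (hn : 1 ≤ n) (ht : t ≠ 0) (hU : 0 < U)
    (hψ : IsGroundState (hubbardRingTV (2 * n) t U).hamiltonian (2 * n) ψ) : IsInSector n n ψ := by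
  rw [← mem_szSector_iff_isInSector, show n + n = 2 * n by ring, sub_self, zero_div]
  exact hubbardRingTV_groundState_mem_szSector hn ht hU hψ

/-- **A UNIT ground state realises the sector minimum of the `U`-pencil**:
`Re ⟨ψ, (Ĥ(t,0) + U·Ĥ(0,1)) ψ⟩ = minEnergyOn (Ĥ(t,0) + U·Ĥ(0,1)) (S_z = 0 sector)` — the hypothesis of
the tree's Griffiths lemma. [folklore] -/
theorem hubbardRingTV_groundState_re_rayleigh (hn : 1 ≤ n)
    (hψ : IsGroundState (hubbardRingTV (2 * n) t U).hamiltonian (2 * n) ψ) (hψ1 : star ψ ⬝ᵥ ψ = 1) :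
    (star ψ ⬝ᵥ ((hubbardRingTV (2 * n) t 0).hamiltonian +
        (((U : ℝ) : ℂ)) • (hubbardRingTV (2 * n) 0 1).hamiltonian) *ᵥ ψ).re =
      ((hubbardRingTV (2 * n) t 0).hamiltonian +
        (((U : ℝ) : ℂ)) • (hubbardRingTV (2 * n) 0 1).hamiltonian).minEnergyOn (szSector (2 * n) (0 : ℝ)) := by
  rw [← hubbardRingTV_hamiltonian_pencil, hψ.2.2, dotProduct_smul, hψ1, smul_eq_mul, mul_one,
    Complex.ofReal_re, hubbardRingTV_hamiltonian_eq]
  change groundEnergyAt (ringGraph (2 * n)) (t : ℝ) (U : ℝ) (2 * n) = _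
  rw [groundEnergyAt_eq_minEnergyOn_szSector (ringGraph (2 * n)) _ _ (by rw [Fintype.card_fin]; omega)]

/-- **`Ĥ(L; 0, 1) = Σ_p n_{p↑} n_{p↓}`**: the `t = 0`, `U = 1` model Hamiltonian is the on-site double
occupancy operator. [folklore] -/
theorem hubbardRingTV_onsite_hamiltonian (L : ℕ) :
    (hubbardRingTV L 0 1).hamiltonian = ∑ p : Fin L, numberOp p 0 * numberOp p 1 := by
  rw [hubbardRingTV_hamiltonian_eq]
  simp [hamiltonian]

/-- `⟨ψ, Ĥ(L; 0, 1) ψ⟩ = Σ_p ⟨n_{p↑} n_{p↓}⟩_ψ` (the total double occupancy). [folklore] -/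
theorem hubbardRingTV_expect_onsite (L : ℕ) (φ : Fock (Orb (Fin L))) :
    star φ ⬝ᵥ (hubbardRingTV L 0 1).hamiltonian *ᵥ φ = ∑ p : Fin L, expect (numberOp p 0 * numberOp p 1) φ := by
  rw [hubbardRingTV_onsite_hamiltonian]
  simp only [Literature.MathematicalPhysics.QuantumLattice.expect, Matrix.sum_mulVec, dotProduct_sum]

/-! ## §2 Feynman–Hellmann supergradient and antitonicity of the double occupancy -/

/-- **FEYNMAN–HELLMANN WITH THE GROUND STATE'S DOUBLE OCCUPANCY**: for a unit ground state `ψ` of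
`hubbardRingTV (2n) t U` (`t ≠ 0`, `U > 0`) and every `U′`,
`E₀(2n; t, U′; n, n) ≤ E₀(2n; t, U; n, n) + (U′ − U)·Σ_p ⟨n_{p↑} n_{p↓}⟩_ψ`. [folklore] -/
theorem hubbardRingTV_energy_le_add_mul_doubleOccupancy (hn : 1 ≤ n) (ht : t ≠ 0) (hU : 0 < U)
    (hψ : IsGroundState (hubbardRingTV (2 * n) t U).hamiltonian (2 * n) ψ) (hψ1 : star ψ ⬝ᵥ ψ = 1) (U' : ℚ) :
    Model.energy (hubbardRingTV (2 * n) t U') n n ≤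
      Model.energy (hubbardRingTV (2 * n) t U) n n +
        ((U' : ℝ) - U) * (∑ p : Fin (2 * n), expect (numberOp p 0 * numberOp p 1) ψ).re := by
  have h := minEnergyOn_pencil_le_of_ground (hubbardRingTV_hamiltonian_isHermitian (2 * n) t 0)
    (hubbardRingTV_hamiltonian_isHermitian (2 * n) 0 1) (szSector (2 * n) (0 : ℝ))
    (hubbardRingTV_groundState_mem_szSector hn ht hU hψ) hψ1
    (hubbardRingTV_groundState_re_rayleigh hn hψ hψ1) (U' : ℝ)
  rw [hubbardRingTV_energy_eq_pencil, hubbardRingTV_energy_eq_pencil, show n + n = 2 * n by ring, sub_self,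
    zero_div, ← hubbardRingTV_expect_onsite]
  exact h

/-- **THE TOTAL GROUND-STATE DOUBLE OCCUPANCY IS NON-INCREASING IN `U`**: for unit ground states `ψ` at
`U` and `φ` at `U′` with `0 < U < U′` (`t ≠ 0`), `Σ_p ⟨n_{p↑} n_{p↓}⟩_φ ≤ Σ_p ⟨n_{p↑} n_{p↓}⟩_ψ` (the
conjugate observable of a Hermitian pencil is antitone along its ground states — Griffiths). [folklore] -/
theorem hubbardRingTV_doubleOccupancy_total_antitone (hn : 1 ≤ n) (ht : t ≠ 0) {U U' : ℚ} (hU : 0 < U)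
    (hUU' : U < U') (hψ : IsGroundState (hubbardRingTV (2 * n) t U).hamiltonian (2 * n) ψ)
    (hψ1 : star ψ ⬝ᵥ ψ = 1) {φ : Fock (Orb (Fin (2 * n)))}
    (hφ : IsGroundState (hubbardRingTV (2 * n) t U').hamiltonian (2 * n) φ) (hφ1 : star φ ⬝ᵥ φ = 1) :
    (∑ p : Fin (2 * n), expect (numberOp p 0 * numberOp p 1) φ).re ≤
      (∑ p : Fin (2 * n), expect (numberOp p 0 * numberOp p 1) ψ).re := by
  have hU' : 0 < U' := hU.trans hUU'
  have h := re_rayleigh_ground_antitone (hubbardRingTV_hamiltonian_isHermitian (2 * n) t 0)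
    (hubbardRingTV_hamiltonian_isHermitian (2 * n) 0 1) (szSector (2 * n) (0 : ℝ))
    (show ((U : ℝ)) < (U' : ℝ) by exact_mod_cast hUU')
    (hubbardRingTV_groundState_mem_szSector hn ht hU hψ) hψ1
    (hubbardRingTV_groundState_re_rayleigh hn hψ hψ1)
    (hubbardRingTV_groundState_mem_szSector hn ht hU' hφ) hφ1
    (hubbardRingTV_groundState_re_rayleigh hn hφ hφ1)
  rwa [hubbardRingTV_expect_onsite, hubbardRingTV_expect_onsite] at h

/-- **THE GROUND-STATE DOUBLE OCCUPANCY PER SITE IS NON-INCREASING IN `U`**: for unit ground states `ψ`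
at `U` and `φ` at `U′`, `0 < U < U′`, `t ≠ 0`, and ANY sites `p, q`:
`⟨n_{p↑} n_{p↓}⟩_φ ≤ ⟨n_{q↑} n_{q↓}⟩_ψ` (the double occupancy is site-independent in each ground state,
`Rows/HubbardRingTVGroundStateSymmetry.lean`). [folklore] -/
theorem hubbardRingTV_doubleOccupancy_antitone (hn : 1 ≤ n) (ht : t ≠ 0) {U U' : ℚ} (hU : 0 < U)
    (hUU' : U < U') (hψ : IsGroundState (hubbardRingTV (2 * n) t U).hamiltonian (2 * n) ψ)
    (hψ1 : star ψ ⬝ᵥ ψ = 1) {φ : Fock (Orb (Fin (2 * n)))}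
    (hφ : IsGroundState (hubbardRingTV (2 * n) t U').hamiltonian (2 * n) φ) (hφ1 : star φ ⬝ᵥ φ = 1)
    (p q : Fin (2 * n)) :
    (expect (numberOp p 0 * numberOp p 1) φ).re ≤ (expect (numberOp q 0 * numberOp q 1) ψ).re := by
  have hU' : 0 < U' := hU.trans hUU'
  have htot := hubbardRingTV_doubleOccupancy_total_antitone hn ht hU hUU' hψ hψ1 hφ hφ1
  have hφu : ∀ x : Fin (2 * n), expect (numberOp x 0 * numberOp x 1) φ = expect (numberOp p 0 * numberOp p 1) φ :=
    fun x => hubbardRingTV_groundState_doubleOccupancy_eq hn ht hU' hφ x p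
  have hψu : ∀ x : Fin (2 * n), expect (numberOp x 0 * numberOp x 1) ψ = expect (numberOp q 0 * numberOp q 1) ψ :=
    fun x => hubbardRingTV_groundState_doubleOccupancy_eq hn ht hU hψ x q
  rw [Finset.sum_congr rfl fun x _ => hφu x, Finset.sum_congr rfl fun x _ => hψu x, Finset.sum_const,
    Finset.sum_const, Finset.card_univ, Fintype.card_fin, nsmul_eq_mul, nsmul_eq_mul, Complex.mul_re,
    Complex.mul_re] at htot
  have h2n : (0 : ℝ) < ((2 * n : ℕ) : ℂ).re := by
    rw [Complex.natCast_re]; exact_mod_cast (by omega : 0 < 2 * n)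
  have him : ((2 * n : ℕ) : ℂ).im = 0 := Complex.natCast_im _
  rw [him, zero_mul, sub_zero, zero_mul, sub_zero] at htot
  exact le_of_mul_le_mul_left htot h2n

end DoubleOccupancy

end Summit.Ventures.CertifiedQuantumChemistry

end
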